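import Literature.LinearAlgebra.Matrix.GerstenhaberNilpotentSubspace
import Literature.LinearAlgebra.Matrix.UnipotentExpShear
import HarnessLib

/-!
# Gerstenhaber's theorem, case of equality: a nilpotent linear subspace of `Mat_n(K)` of the maximal
dimension `n(n−1)/2` is similar to the space of strictly upper triangular matrices

Source (held, read at the page): [dSP13] = C. de Seguins Pazzis, *On Gerstenhaber's theorem for spaces
of nilpotent matrices over a skew field*, Linear Algebra Appl. 438 (2013) 4426–4438, arXiv:1210.4951
[deSeguinsPazzis2013Gerstenhaber] (held text `paper:arxiv-1210.4951`):

* p. 3, "Theorem 1 (Gerstenhaber, Serezhkin). Assume that `𝕂` is commutative, and let `𝒱` be a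
  nilpotent linear subspace of the `𝕂`-vector space `Mat_n(𝕂)`. Then `dim_𝕂 𝒱 ≤ binom(n,2)`, and equality
  occurs if and only if `𝒱` is similar to `NT_n(𝕂)`." (`NT_n(𝕂)` = "the set of all strictly
  upper-triangular matrices of `Mat_n(𝕂)`", p. 3; "similar": `P 𝒱 P⁻¹` for `P ∈ GL_n(𝕂)`, p. 3.)
  The theorem is M. Gerstenhaber, Amer. J. Math. 80 (1958) 614–622 [Gerstenhaber1958] (fields with
  `≥ n` elements); the case of equality over an arbitrary field is due to V. N. Serezhkin (1985)
  ([dSP13] p. 3: "the case of equality has been obtained for an arbitrary field by V.N. Serezhkin");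
  [dSP13] §4 (pp. 6–9) re-proves it by the "diagonal-compatibility method" (Theorem 2 (b), `q = 1`).

The INEQUALITY half and the key Lemma 5 are PROVED in the tree
(`Literature/LinearAlgebra/Matrix/GerstenhaberNilpotentSubspace.lean`: `exists_adapted`,
`finrank_le_choose_two`). This file adds the CASE OF EQUALITY:

* `deSeguinsPazzis2013_equality` — NAMED FACT (not proved here): Theorem 1, case of equality, for a
  commutative field `K` (`𝕂 = 𝕂₀`, `q = 1`) and every `n`: a nilpotent linear subspace `V` of
  `Mat_n(K)` with `dim V = binom(n,2)` satisfies `V = {A : P A P⁻¹ ∈ NT_n(K)}` (i.e. `P V P⁻¹ = NT_n(K)`)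
  for some `P ∈ GL_n(K)`. Vocabulary: `NT_n(K)` is the tree's predicate `IsStrictUpper`
  (`Literature/LinearAlgebra/Matrix/UnipotentExpShear.lean`), `GL_n` membership is `IsUnit P`,
  `P⁻¹` is Mathlib's nonsingular inverse.
* PROVED from the fact (any field, any `n`, any `k ≤ n`): `exists_sqZero_subspace_of_equality` — such a
  `V` contains a linear subspace `W` of dimension `k(n−k)` with `W·W = 0` (namely
  `P⁻¹ 𝔫^{P_k} P`, where `𝔫^{P_k} = {Z : Z i j = 0 unless i < k ≤ j}` is the tree's `IsBlockOffDiag k`,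
  square-zero by `IsBlockOffDiag.mul_eq_zero`), and its `4 × 4`, `k = 2` instance
  `exists_sqZero_of_equality_four` ("every `6`-dimensional nilpotent linear subspace of `Mat_4(K)`
  contains a `4`-dimensional subspace of square-zero matrices" — the form consumed summit-side).
* PROVED unconditionally: `conjEquiv` (conjugation `A ↦ P A P⁻¹` as a linear equivalence),
  `isNilpotent_conjEquiv_iff` ([dSP13] §1: similarity preserves nilpotency); `blockOffDiag`,
  `blockOffDiagEquivFun` (`𝔫^{P_k}` as a submodule, `≃` functions on the `k × (n−k)` block);
  `finrank_eq_choose_two_of_forall_mem_iff` (`dim NT_n(K) = binom(n,2)`, [dSP13] §4.8); and the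
  converse (easy) direction of the equality case, `finrank_eq_choose_two_of_similar` (`V` similar to
  `NT_n(K)` ⇒ `dim V = binom(n,2)` and `V` is nilpotent).

NOT here: the proof of the case of equality ([dSP13] §4) — the fact is stated, its discharge
`deSeguinsPazzis2013_equality_holds` is owed (append protocol, this file); the skew-field version
(Theorem 2 with the factor `q`); Corollary 3 (additive subgroups over finite fields).
One named fact; the two `Submodule`-valued definitions (`conjEquiv`, `blockOffDiag`) only package
existing operations/predicates (conjugation; `IsBlockOffDiag`) — no new notion.
-/

open Matrix

namespace Literature.LinearAlgebra.Matrix.GerstenhaberNilpotentSubspace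

variable {K : Type*} [Field K] {n : ℕ}

/-! ## Conjugation by an invertible matrix -/

/-- Conjugation `A ↦ P A P⁻¹` by a matrix `P` with invertible determinant, as a `K`-linear
equivalence of `Mat_n(K)` (inverse `B ↦ P⁻¹ B P`; `P⁻¹` is the nonsingular inverse). [folklore] -/
noncomputable def conjEquiv (P : Matrix (Fin n) (Fin n) K) (hP : IsUnit P.det) :
    Matrix (Fin n) (Fin n) K ≃ₗ[K] Matrix (Fin n) (Fin n) K where
  toFun A := P * A * P⁻¹
  invFun B := P⁻¹ * B * P
  map_add' A B := by rw [Matrix.mul_add, Matrix.add_mul]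
  map_smul' c A := by rw [Matrix.mul_smul, Matrix.smul_mul, RingHom.id_apply]
  left_inv A := by
    show P⁻¹ * (P * A * P⁻¹) * P = A
    rw [Matrix.mul_assoc P, Matrix.nonsing_inv_mul_cancel_left _ _ hP,
      Matrix.nonsing_inv_mul_cancel_right _ _ hP]
  right_inv B := by
    show P * (P⁻¹ * B * P) * P⁻¹ = B
    rw [Matrix.mul_assoc P⁻¹, Matrix.mul_nonsing_inv_cancel_left _ _ hP,
      Matrix.mul_nonsing_inv_cancel_right _ _ hP]

/-- Unfolding `conjEquiv`. [folklore] -/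
@[simp] private theorem conjEquiv_apply (P : Matrix (Fin n) (Fin n) K) (hP : IsUnit P.det)
    (A : Matrix (Fin n) (Fin n) K) : conjEquiv P hP A = P * A * P⁻¹ := rfl

/-- Unfolding the inverse of `conjEquiv`. [folklore] -/
@[simp] private theorem conjEquiv_symm_apply (P : Matrix (Fin n) (Fin n) K) (hP : IsUnit P.det)
    (B : Matrix (Fin n) (Fin n) K) : (conjEquiv P hP).symm B = P⁻¹ * B * P := rfl

/-- Conjugation is multiplicative. [folklore] -/
private theorem conjEquiv_mul (P : Matrix (Fin n) (Fin n) K) (hP : IsUnit P.det)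
    (A B : Matrix (Fin n) (Fin n) K) :
    conjEquiv P hP (A * B) = conjEquiv P hP A * conjEquiv P hP B := by
  simp only [conjEquiv_apply]
  rw [Matrix.mul_assoc (P * A) P⁻¹, ← Matrix.mul_assoc P⁻¹, ← Matrix.mul_assoc P⁻¹,
    Matrix.nonsing_inv_mul _ hP, Matrix.one_mul, ← Matrix.mul_assoc, ← Matrix.mul_assoc]

/-- Conjugation commutes with powers. [folklore] -/
private theorem conjEquiv_pow (P : Matrix (Fin n) (Fin n) K) (hP : IsUnit P.det)
    (A : Matrix (Fin n) (Fin n) K) (m : ℕ) : conjEquiv P hP (A ^ m) = (conjEquiv P hP A) ^ m := by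
  induction m with
  | zero => rw [pow_zero, pow_zero, conjEquiv_apply, Matrix.mul_one, Matrix.mul_nonsing_inv _ hP]
  | succ m ih => rw [pow_succ, pow_succ, conjEquiv_mul, ih]

/-- **Conjugation preserves nilpotency** ([dSP13] §1, p. 3: "for every `P ∈ GL_n(𝕂)`, the set
`P𝒱P⁻¹` is a nilpotent linear subspace of `Mat_n(𝕂)` with the same dimension as `𝒱`"; the dimension
half is Mathlib's `LinearEquiv.finrank_map_eq` for `conjEquiv`). [cite: deSeguinsPazzis2013Gerstenhaber, §1 (p. 3 of arXiv:1210.4951)] -/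
theorem isNilpotent_conjEquiv_iff (P : Matrix (Fin n) (Fin n) K) (hP : IsUnit P.det)
    (A : Matrix (Fin n) (Fin n) K) : IsNilpotent (conjEquiv P hP A) ↔ IsNilpotent A := by
  constructor
  · rintro ⟨m, hm⟩
    refine ⟨m, (conjEquiv P hP).injective ?_⟩
    rw [conjEquiv_pow, hm, map_zero]
  · rintro ⟨m, hm⟩
    exact ⟨m, by rw [← conjEquiv_pow, hm, map_zero]⟩

/-! ## The square-zero block `𝔫^{P_k}` as a submodule, and its dimension -/

variable (K n) in
/-- The off-diagonal block `𝔫^{P_k} = {Z ∈ Mat_n(K) : Z i j = 0 unless i < k ≤ j}` of the maximal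
standard parabolic `P_k`, as a `K`-submodule: the carrier is exactly the tree's predicate
`IsBlockOffDiag k` (`UnipotentExpShear.lean`). [folklore] -/
def blockOffDiag (k : ℕ) : Submodule K (Matrix (Fin n) (Fin n) K) where
  carrier := {Z | IsBlockOffDiag k Z}
  zero_mem' := isBlockOffDiag_zero
  add_mem' hZ hZ' := hZ.add hZ'
  smul_mem' c _ hZ := hZ.smul c

/-- Membership in `blockOffDiag`. [folklore] -/
private theorem mem_blockOffDiag {k : ℕ} {Z : Matrix (Fin n) (Fin n) K} :
    Z ∈ blockOffDiag K n k ↔ IsBlockOffDiag k Z := Iff.rfl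

/-- Reading off the block entries `(i, k + j)`, `i < k`, `j < n - k`. [folklore] -/
private def blockRead (k : ℕ) (hk : k ≤ n) (Z : Matrix (Fin n) (Fin n) K)
    (p : Fin k × Fin (n - k)) : K :=
  Z ⟨p.1, by omega⟩ ⟨k + p.2, by omega⟩

/-- Filling the block positions `i < k ≤ j` from a function on `Fin k × Fin (n - k)`, zero elsewhere.
[folklore] -/
private def blockFill (k : ℕ) (f : Fin k × Fin (n - k) → K) : Matrix (Fin n) (Fin n) K :=
  Matrix.of fun i j => if h : (i : ℕ) < k ∧ k ≤ (j : ℕ) then f (⟨i, h.1⟩, ⟨j - k, by omega⟩) else 0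

/-- `blockFill` lands in the block. [folklore] -/
private theorem isBlockOffDiag_blockFill (k : ℕ) (f : Fin k × Fin (n - k) → K) :
    IsBlockOffDiag k (blockFill k f) := by
  intro i j hij
  rw [blockFill, Matrix.of_apply, dif_neg]
  omega

/-- `blockRead ∘ blockFill = id`. [folklore] -/
private theorem blockRead_blockFill (k : ℕ) (hk : k ≤ n) (f : Fin k × Fin (n - k) → K) :
    blockRead k hk (blockFill k f) = f := by
  funext p
  obtain ⟨⟨a, ha⟩, ⟨b, hb⟩⟩ := p
  simp only [blockRead, blockFill, Matrix.of_apply]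
  rw [dif_pos ⟨ha, Nat.le_add_right k b⟩]
  congr
  omega

/-- `blockFill ∘ blockRead = id` on the block. [folklore] -/
private theorem blockFill_blockRead (k : ℕ) (hk : k ≤ n) {Z : Matrix (Fin n) (Fin n) K}
    (hZ : IsBlockOffDiag k Z) : blockFill k (blockRead k hk Z) = Z := by
  ext ⟨i, hi⟩ ⟨j, hj⟩
  simp only [blockRead, blockFill, Matrix.of_apply]
  by_cases h : i < k ∧ k ≤ j
  · rw [dif_pos h]
    congr
    omega
  · rw [dif_neg h]
    exact (hZ ⟨i, hi⟩ ⟨j, hj⟩ (show k ≤ i ∨ j < k by omega)).symm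

/-- `𝔫^{P_k}` is linearly isomorphic to the functions on the `k × (n − k)` block of positions
`(i, j)` with `i < k ≤ j`. [folklore] -/
noncomputable def blockOffDiagEquivFun (k : ℕ) (hk : k ≤ n) :
    blockOffDiag K n k ≃ₗ[K] (Fin k × Fin (n - k) → K) where
  toFun Z := blockRead k hk (Z : Matrix (Fin n) (Fin n) K)
  invFun f := ⟨blockFill k f, isBlockOffDiag_blockFill k f⟩
  map_add' Z Z' := by funext p; rfl
  map_smul' c Z := by funext p; rfl
  left_inv Z := Subtype.ext (blockFill_blockRead k hk Z.2)
  right_inv f := blockRead_blockFill k hk f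

/-- `dim 𝔫^{P_k} = k(n − k)`. [folklore] -/
private theorem finrank_blockOffDiag (k : ℕ) (hk : k ≤ n) :
    Module.finrank K (blockOffDiag K n k) = k * (n - k) := by
  rw [(blockOffDiagEquivFun k hk).finrank_eq, Module.finrank_fintype_fun_eq_card,
    Fintype.card_prod, Fintype.card_fin, Fintype.card_fin]

/-! ## The dimension of `NT_n(K)` -/

/-- The number of positions strictly above the diagonal of an `n × n` array is `binom(n,2)`.
[folklore] -/
private theorem card_lt_pairs (n : ℕ) : Fintype.card {p : Fin n × Fin n // p.1 < p.2} = n.choose 2 := by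
  have hle : Fintype.card {p : Fin n × Fin n // p.1 ≤ p.2} = (n + 1).choose 2 := by
    rw [← Fintype.card_congr Sym2.sortEquiv, Sym2.card, Fintype.card_fin]
  rw [Fintype.card_subtype] at hle ⊢
  have hsplit : (Finset.univ.filter fun p : Fin n × Fin n => p.1 ≤ p.2) =
      (Finset.univ.filter fun p : Fin n × Fin n => p.1 < p.2) ∪
        (Finset.univ.filter fun p : Fin n × Fin n => p.1 = p.2) := by
    rw [← Finset.filter_or]
    exact Finset.filter_congr fun p _ => le_iff_lt_or_eq
  have hdisj : Disjoint (Finset.univ.filter fun p : Fin n × Fin n => p.1 < p.2)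
      (Finset.univ.filter fun p : Fin n × Fin n => p.1 = p.2) :=
    Finset.disjoint_filter.2 fun p _ h1 h2 => (ne_of_lt h1) h2
  have hdiag : (Finset.univ.filter fun p : Fin n × Fin n => p.1 = p.2).card = n := by
    have h : (Finset.univ.filter fun p : Fin n × Fin n => p.1 = p.2) =
        (Finset.univ : Finset (Fin n)).diag := by
      ext p
      simp [Finset.mem_diag]
    rw [h, Finset.diag_card, Finset.card_univ, Fintype.card_fin]
  have h2 : (n + 1).choose 2 = n + n.choose 2 := by
    rw [show 2 = 1 + 1 from rfl, Nat.choose_succ_succ', Nat.choose_one_right]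
  rw [hsplit, Finset.card_union_of_disjoint hdisj, hdiag, h2] at hle
  omega

/-- **`dim NT_n(K) = binom(n,2)`** ([dSP13] §4.8, p. 9: "`dim_{𝕂₀} 𝒱 = q binom(n,2) = dim_{𝕂₀} NT_n(𝕂)`",
here `q = 1`), stated definition-free: for any submodule whose members are exactly the strictly upper
triangular matrices. [cite: deSeguinsPazzis2013Gerstenhaber, §4.8 (p. 9 of arXiv:1210.4951)] -/
theorem finrank_eq_choose_two_of_forall_mem_iff (N : Submodule K (Matrix (Fin n) (Fin n) K))
    (hN : ∀ A, A ∈ N ↔ IsStrictUpper A) : Module.finrank K N = n.choose 2 := by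
  let e : N ≃ₗ[K] ({p : Fin n × Fin n // p.1 < p.2} → K) :=
    { toFun := fun A p => (A : Matrix (Fin n) (Fin n) K) p.1.1 p.1.2
      invFun := fun f => ⟨Matrix.of fun i j => if h : i < j then f ⟨(i, j), h⟩ else 0, by
        rw [hN]
        intro i j hij
        rw [Matrix.of_apply, dif_neg (not_lt.2 hij)]⟩
      map_add' := fun A B => by funext p; rfl
      map_smul' := fun c A => by funext p; rfl
      left_inv := fun A => by
        apply Subtype.ext
        ext i j
        simp only [Matrix.of_apply]
        by_cases h : i < j
        · rw [dif_pos h]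
        · rw [dif_neg h]
          exact ((hN _).1 A.2 i j (not_lt.1 h)).symm
      right_inv := fun f => by
        funext p
        simp only [Matrix.of_apply]
        rw [dif_pos p.2] }
  rw [e.finrank_eq, Module.finrank_fintype_fun_eq_card, card_lt_pairs]

/-! ## Theorem 1, case of equality (named fact) and its converse -/

/-- **Gerstenhaber's theorem, case of equality** ([dSP13] Theorem 1, second half = Theorem 2 (b) with
`q = 1`; Gerstenhaber 1958 for `#K ≥ n`, Serezhkin 1985 for all fields): "Assume that `𝕂` is
commutative, and let `𝒱` be a nilpotent linear subspace of the `𝕂`-vector space `Mat_n(𝕂)`. Then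
`dim_𝕂 𝒱 ≤ binom(n,2)`, and equality occurs if and only if `𝒱` is similar to `NT_n(𝕂)`." — here the
"only if": for every field `K`, every `n` and every linear subspace `V` of `Mat_n(K)` all of whose
members are nilpotent, if `dim_K V = binom(n,2)` then there is `P ∈ GL_n(K)` with `P V P⁻¹ = NT_n(K)`,
i.e. `V = {A : P A P⁻¹ is strictly upper triangular}` (`IsStrictUpper`). Typed statement (named
fact), NOT proved here; the printed proof is [dSP13] §4. [cite: deSeguinsPazzis2013Gerstenhaber, Theorem 1 (case of equality; proof §4, pp. 6–9 of arXiv:1210.4951)] -/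
def deSeguinsPazzis2013_equality : Prop :=
  ∀ (K : Type) [Field K] (n : ℕ) (V : Submodule K (Matrix (Fin n) (Fin n) K)),
    (∀ A ∈ V, IsNilpotent A) → Module.finrank K V = n.choose 2 →
      ∃ P : Matrix (Fin n) (Fin n) K, IsUnit P ∧ ∀ A, A ∈ V ↔ IsStrictUpper (P * A * P⁻¹)

/-- The converse ("if") direction of the case of equality, proved: a linear subspace of `Mat_n(K)`
similar to `NT_n(K)` has dimension `binom(n,2)` (and consists of nilpotent matrices).
[cite: deSeguinsPazzis2013Gerstenhaber, Theorem 1] -/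
theorem finrank_eq_choose_two_of_similar (V : Submodule K (Matrix (Fin n) (Fin n) K))
    (P : Matrix (Fin n) (Fin n) K) (hP : IsUnit P)
    (hV : ∀ A, A ∈ V ↔ IsStrictUpper (P * A * P⁻¹)) :
    Module.finrank K V = n.choose 2 ∧ ∀ A ∈ V, IsNilpotent A := by
  have hPdet : IsUnit P.det := (Matrix.isUnit_iff_isUnit_det P).1 hP
  -- `P V P⁻¹` is the submodule of strictly upper triangular matrices
  have hmap : ∀ B, B ∈ V.map (conjEquiv P hPdet).toLinearMap ↔ IsStrictUpper B := by
    intro B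
    constructor
    · rintro ⟨A, hA, rfl⟩
      exact (hV A).1 hA
    · intro hB
      refine ⟨(conjEquiv P hPdet).symm B, ?_, (conjEquiv P hPdet).apply_symm_apply B⟩
      show (conjEquiv P hPdet).symm B ∈ V
      rw [hV, ← conjEquiv_apply P hPdet, (conjEquiv P hPdet).apply_symm_apply B]
      exact hB
  refine ⟨?_, fun A hA => ?_⟩
  · rw [← LinearEquiv.finrank_map_eq (conjEquiv P hPdet) V]
    exact finrank_eq_choose_two_of_forall_mem_iff _ hmap
  · rw [← isNilpotent_conjEquiv_iff P hPdet]
    exact ((hV A).1 hA).isNilpotent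

/-! ## Consequence: large square-zero subspaces -/

/-- **A nilpotent space of the maximal dimension contains `P⁻¹ 𝔫^{P_k} P`**: granted the case of
equality, a linear subspace `V` of nilpotent `n × n` matrices with `dim V = binom(n,2)` contains, for
each `k ≤ n`, a linear subspace `W` of dimension `k(n − k)` with `W · W = 0`. (For `V = NT_n(K)` take
`W = 𝔫^{P_k}`, the matrices supported on the positions `i < k ≤ j`; in general conjugate.)
[cite: deSeguinsPazzis2013Gerstenhaber, Theorem 1 (consequence)] -/
theorem exists_sqZero_subspace_of_equality (h : deSeguinsPazzis2013_equality) {K : Type} [Field K]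
    {n : ℕ} (k : ℕ) (hk : k ≤ n) (V : Submodule K (Matrix (Fin n) (Fin n) K))
    (hV : ∀ A ∈ V, IsNilpotent A) (hdim : Module.finrank K V = n.choose 2) :
    ∃ W : Submodule K (Matrix (Fin n) (Fin n) K), W ≤ V ∧ Module.finrank K W = k * (n - k) ∧
      ∀ Q ∈ W, ∀ Q' ∈ W, Q * Q' = 0 := by
  obtain ⟨P, hP, hPV⟩ := h K n V hV hdim
  have hPdet : IsUnit P.det := (Matrix.isUnit_iff_isUnit_det P).1 hP
  refine ⟨(blockOffDiag K n k).comap (conjEquiv P hPdet).toLinearMap, ?_, ?_, ?_⟩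
  · intro Q hQ
    rw [Submodule.mem_comap, LinearEquiv.coe_coe, mem_blockOffDiag, conjEquiv_apply] at hQ
    exact (hPV Q).2 hQ.isStrictUpper
  · rw [Submodule.comap_equiv_eq_map_symm, LinearEquiv.finrank_map_eq]
    exact finrank_blockOffDiag k hk
  · intro Q hQ Q' hQ'
    rw [Submodule.mem_comap, LinearEquiv.coe_coe, mem_blockOffDiag] at hQ hQ'
    have h0 : conjEquiv P hPdet (Q * Q') = 0 := by
      rw [conjEquiv_mul]
      exact hQ.mul_eq_zero hQ'
    exact (conjEquiv P hPdet).injective (h0.trans (map_zero _).symm)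

/-- **The `4 × 4` case in the form used summit-side**: granted the case of equality, every
`6`-dimensional linear subspace of nilpotent `4 × 4` matrices over a field `K` contains a linear
subspace of dimension `≥ 4` consisting of square-zero matrices (a conjugate of
`span{E₁₃, E₁₄, E₂₃, E₂₄} ⊂ NT_4(K)`). [cite: deSeguinsPazzis2013Gerstenhaber, Theorem 1 (consequence, n = 4)] -/
theorem exists_sqZero_of_equality_four (h : deSeguinsPazzis2013_equality) {K : Type} [Field K]
    (V : Submodule K (Matrix (Fin 4) (Fin 4) K)) (hV : ∀ A ∈ V, IsNilpotent A)
    (h6 : Module.finrank K V = 6) :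
    ∃ W : Submodule K (Matrix (Fin 4) (Fin 4) K), W ≤ V ∧ 4 ≤ Module.finrank K W ∧
      ∀ Q ∈ W, Q * Q = 0 := by
  obtain ⟨W, hWV, hW, hsq⟩ :=
    exists_sqZero_subspace_of_equality h 2 (by norm_num) V hV (by rw [h6]; decide)
  exact ⟨W, hWV, by rw [hW], fun Q hQ => hsq Q hQ Q hQ⟩

end Literature.LinearAlgebra.Matrix.GerstenhaberNilpotentSubspace
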